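import Summits.NavierStokesRegularity.NavierStokesRegularity.Theorems.PerpetualPumpAveragedTypeIBlowupHandoffSlow
import Summits.NavierStokesRegularity.NavierStokesRegularity.Theorems.PerpetualPumpAveragedTypeIBlowupPreBootRegime
import Summits.NavierStokesRegularity.NavierStokesRegularity.Theorems.PerpetualPumpAveragedTypeIBlowupSlavedLadder

/-!
# Crux `PerpetualPump.AveragedTypeIBlowup` (stmt-NavierStokesRegularity-1835), line `Sketch`:
# stub `pulseBoot` — the slaved ladder with a loose next-bond feed

Fourth file of the proof of the registered stub `stub_pulseBoot`. The ladder of modes two or more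
scales above the front stays under the profile `lad` on `[t₀, S]` as long as the next bond is
bounded by any `Yl` with `Yl² ≤ ε̄/5` (`pulseBoot_ladder`, an instance of the landed
`stub_slavedLadder`; the closure inequalities `pulseBoot_ladder_closure` = registered tools
sub-goal `stub_pulseBootLadder`). This covers both the pre-ignition feed `1.1 ε̄` and the
pulse-phase feed `2Y₁`.

## References

T. Tao, *Finite time blowup for an averaged three-dimensional Navier–Stokes equation*, J. Amer.
Math. Soc. 29 (2016), 601–674, §5–6 (the cascade / transfer-pulse heuristics); the content here is
folklore ODE calculus (comparison, Duhamel bounds, continuous induction).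
-/

noncomputable section

-- the summit namespace `…NavierStokesRegularity.NavierStokesRegularity…` is the tree convention
set_option linter.dupNamespace false

open Set MeasureTheory Filter Topology

namespace Summit.NavierStokesRegularity.NavierStokesRegularity.Theorems.PerpetualPumpAveragedTypeIBlowup

/-- **Closure of the ladder box under the forcings, loose feed** (the four algebraic inequalities
of `stub_slavedLadder` for the profile box `X = MX = MY = L`, `Y = L/5` at one rung, given the rung
below contributes only `Yp² ≤ L/5` — the pulse-phase size of the next bond — and the rung above
`Lp ≤ ε̄`; `L ≤ ε̄ ≤ 10⁻⁶`, `η ≤ 10⁻⁹`). [folklore] -/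
theorem pulseBoot_ladder_closure {L Lp Yp εb η θ q : ℝ} (hθ : 1 / 2 ≤ θ) (hq : 1 ≤ q)
    (hη : η ≤ 1 / 10 ^ 9) (hεb : 0 < εb) (hεb6 : εb ≤ 1 / 10 ^ 6) (hL : 0 ≤ L)
    (hLε : L ≤ εb) (hLp : 0 ≤ Lp) (hLpε : Lp ≤ εb) (hYp : Yp ^ 2 ≤ L / 5) :
    Yp ^ 2 / q ^ 3 + (L / 5) ^ 2 + εb * L * (L / 5) + η * L ≤ L / 2 ∧
    εb * L ^ 2 + η * L ≤ L / 5 / 4 ∧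
    (Yp ^ 2 / q ^ 3 + (L / 5) ^ 2 + εb * L * (L / 5)) / θ ≤ L / 2 ∧
    (L / 5 * (L + Lp / q + 1) + εb * L ^ 2) / θ ≤ L / 2 := by
  have hθ0 : 0 < θ := by linarith
  have hq0 : 0 < q := by linarith
  have hYp' : Yp ^ 2 / q ^ 3 ≤ L / 5 :=
    (div_le_self (sq_nonneg _) (one_le_pow₀ hq)).trans hYp
  have hεL : εb * L ≤ 1 / 10 ^ 6 * L := mul_le_mul_of_nonneg_right hεb6 hL
  have hLL : L * L ≤ 1 / 10 ^ 6 * L := (mul_le_mul_of_nonneg_right hLε hL).trans hεL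
  have hηL : η * L ≤ 1 / 10 ^ 9 * L := mul_le_mul_of_nonneg_right hη hL
  have hεLL : εb * L * L ≤ 1 / 10 ^ 6 * L := by
    have h1 : εb * (L * L) ≤ 1 * (L * L) :=
      mul_le_mul_of_nonneg_right (by linarith [hεb6]) (mul_self_nonneg _)
    have h2 : εb * L * L = εb * (L * L) := by ring
    linarith
  have hLq : Lp / q ≤ εb := (div_le_self hLp hq).trans hLpε
  have hLLq : L * (Lp / q) ≤ 1 / 10 ^ 6 * L := by
    have h1 : L * (Lp / q) ≤ L * εb := mul_le_mul_of_nonneg_left hLq hL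
    linarith
  have e1 : (L / 5) ^ 2 = L * L / 25 := by ring
  have e2 : εb * L * (L / 5) = εb * L * L / 5 := by ring
  have e3 : εb * L ^ 2 = εb * L * L := by ring
  have e4 : L / 5 * (L + Lp / q + 1) = L * L / 5 + L * (Lp / q) / 5 + L / 5 := by ring
  have hθL : L / 4 ≤ L / 2 * θ := by nlinarith
  refine ⟨?_, ?_, ?_, ?_⟩
  · rw [e1, e2]
    linarith
  · rw [e3]
    linarith
  · rw [div_le_iff₀ hθ0, e1, e2]
    linarith
  · rw [div_le_iff₀ hθ0, e4, e3]
    linarith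

/-- **The slaved ladder under a loose next-bond feed.** On `[t₀, S]`: if the level-1 bond is
bounded by `Yl` with `Yl² ≤ ε̄/5` (this covers the pre-ignition size `1.1 ε̄` and the pulse-phase
size `2Y₁`), the modes `j ≥ 2` scales above the front stay under the profile `lad`
(`|b| ≤ lad j`, `|w| ≤ lad j / 5`, majorants `≤ lad j`): `stub_slavedLadder` in the front clock
with `X = MX = MY = lad`, `Y = lad/5` (`Y₁ = Yl`), relative rates `(1+ε₀)^{2j}`, the far tail from
the a-priori tail hypothesis and the initial box from the hand-off invariant. [folklore] -/
theorem pulseBoot_ladder {ε₀ D εb θ η F bhi q T t₀ S Yl : ℝ} {n : ℤ} {lad : ℕ → ℝ}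
    {bv wv M0 M1 db dw G0 G1 : ℤ → ℝ → ℝ} {R : ℤ → ℝ}
    (hq : q = Real.sqrt (1 + ε₀)) (hR : ∀ k : ℤ, R k = D * (1 + ε₀) ^ (2 * k))
    (hlad : ∀ j : ℕ, lad j = εb * ((1 + ε₀) ^ (19 * (j - 2)))⁻¹)
    (hG0 : ∀ (k : ℤ) (t : ℝ), G0 k t = (wv (k - 1) t) ^ 2 / q ^ 3 - (wv k t) ^ 2 - εb * bv k t * wv k t)
    (hG1 : ∀ (k : ℤ) (t : ℝ), G1 k t = wv k t * (bv k t - bv (k + 1) t / q) + εb * (bv k t) ^ 2)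
    (hε₀ : 0 < ε₀) (hε₀' : ε₀ ≤ 1 / 20) (hD : 0 < D) (hθ : 1 / 2 ≤ θ) (hθ1 : θ ≤ 1) (hη : 0 ≤ η)
    (hεb : 0 < εb) (hεb6 : εb ≤ 1 / 10 ^ 6) (hF0 : 0 ≤ F) (hbhi : 1 ≤ bhi + 4)
    (hηreg : η * (10 ^ 9 * (bhi + 4) ^ 4 * (F + 1)) ≤ 1)
    (hcont : ∀ k : ℤ, ContinuousOn (bv k) (Icc 0 T) ∧ ContinuousOn (wv k) (Icc 0 T) ∧
      ContinuousOn (M0 k) (Icc 0 T) ∧ ContinuousOn (M1 k) (Icc 0 T))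
    (hC1 : ∀ k : ℤ, ContinuousOn (db k) (Icc 0 T) ∧ ContinuousOn (dw k) (Icc 0 T) ∧
      ∀ t ∈ Ioo 0 T, HasDerivAt (bv k) (db k t) t ∧
        |db k t - R k * (-(bv k t) + G0 k t)| ≤ η * R k * M0 k t ∧
        HasDerivAt (wv k) (dw k t) t ∧ |dw k t - R k * (-(wv k t) + G1 k t)| ≤ η * R k * M1 k t)
    (hmaj : ∀ k : ℤ, ∀ t ∈ Icc 0 T, |bv k t| ≤ M0 k t ∧ |wv k t| ≤ M1 k t ∧ 0 ≤ M0 k t ∧ 0 ≤ M1 k t)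
    (hrest : ∀ k : ℤ, ∀ t₁ ∈ Icc 0 T, ∀ t₂ ∈ Icc t₁ T,
      M0 k t₂ ≤ M0 k t₁ * Real.exp (-(θ * R k * (t₂ - t₁))) +
          R k * ∫ u in t₁..t₂, Real.exp (-(θ * R k * (t₂ - u))) * |G0 k u| ∧
        M1 k t₂ ≤ M1 k t₁ * Real.exp (-(θ * R k * (t₂ - t₁))) +
          R k * ∫ u in t₁..t₂, Real.exp (-(θ * R k * (t₂ - u))) * |G1 k u|)
    (hT : 0 < T) (ht₀ : 0 ≤ t₀) (hS : t₀ ≤ S) (hST : S ≤ T)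
    (hTail : ∃ J : ℕ, ∀ j : ℕ, J ≤ j → ∀ t ∈ Icc 0 T,
      |bv (n + j) t| ≤ lad j ∧ |wv (n + j) t| ≤ lad j / 5 ∧ M0 (n + j) t ≤ lad j ∧ M1 (n + j) t ≤ lad j)
    (hInvL : ∀ j : ℕ, 2 ≤ j → |bv (n + j) t₀| ≤ lad j ∧ |wv (n + j) t₀| ≤ lad j / 5 ∧
      M0 (n + j) t₀ ≤ lad j ∧ M1 (n + j) t₀ ≤ lad j)
    (hYl0 : 0 ≤ Yl) (hYl : Yl ^ 2 ≤ εb / 5) (hL1 : ∀ u ∈ Icc t₀ S, |wv (n + 1) u| ≤ Yl) :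
    ∀ j : ℕ, 2 ≤ j → ∀ u ∈ Icc t₀ S, |bv (n + j) u| ≤ lad j ∧ |wv (n + j) u| ≤ lad j / 5 ∧
      M0 (n + j) u ≤ lad j ∧ M1 (n + j) u ≤ lad j := by
  obtain ⟨hRpos, -, -, -, -, hκ1, -, -, -, hq0, hq2⟩ := preBoot_rates hε₀ hε₀' hD hR hq n
  have hq1 : 1 ≤ q := by nlinarith
  have hRn := hRpos n
  obtain ⟨hη9, -⟩ := preBoot_eta hη hF0 hbhi hηreg
  obtain ⟨J, hJ⟩ := hTail
  -- slow time of the front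
  set S' := R n * (S - t₀) with hS'
  have hS'0 : 0 ≤ S' := mul_nonneg hRn.le (by linarith)
  have hST' : t₀ + S' / R n ≤ T := by
    rw [hS', mul_div_cancel_left₀ _ hRn.ne']
    linarith
  have hpk := fun k : ℤ =>
    handoff_sysPkg (k := k) hG0 hG1 hcont hC1 hmaj hrest hRn hT ht₀ hS'0 hST'
  -- clock algebra of the slow time from `t₀`
  have hmem : ∀ σ ∈ Icc 0 S', t₀ + σ / R n ∈ Icc t₀ S := by
    intro σ hσ
    have h0 : 0 ≤ σ / R n := div_nonneg hσ.1 hRn.le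
    have h1 : σ / R n ≤ S' / R n := div_le_div_of_nonneg_right hσ.2 hRn.le
    rw [hS', mul_div_cancel_left₀ _ hRn.ne'] at h1
    exact ⟨by linarith, by linarith⟩
  have htime1 : ∀ s : ℝ, t₀ + R n * (s - t₀) / R n = s := fun s => by field_simp; ring
  have htime : ∀ σ : ℝ, R n * ((t₀ + σ / R n) - t₀) = σ := fun σ => by field_simp; ring
  have ht00 : t₀ + 0 / R n = t₀ := by simp
  have hmemT : ∀ σ ∈ Icc 0 S', t₀ + σ / R n ∈ Icc 0 T := fun σ hσ =>
    ⟨ht₀.trans (hmem σ hσ).1, (hmem σ hσ).2.trans hST⟩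
  -- the profile
  have hpow1 : ∀ i : ℕ, 1 ≤ (1 + ε₀) ^ i := fun i => one_le_pow₀ (by linarith)
  have hlad0 : ∀ j : ℕ, 0 < lad j := fun j => by
    rw [hlad]
    exact mul_pos hεb (inv_pos.2 (lt_of_lt_of_le zero_lt_one (hpow1 _)))
  have hladε : ∀ j : ℕ, lad j ≤ εb := fun j => by
    rw [hlad]
    exact mul_le_of_le_one_right hεb.le (inv_le_one_of_one_le₀ (hpow1 _))
  have hlad2 : lad 2 = εb := by rw [hlad]; norm_num
  have hladsucc : ∀ j : ℕ, 2 ≤ j → lad j ≤ 3 * lad (j + 1) := by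
    intro j hj
    have h19 := preBoot_pow19 hε₀.le hε₀'
    rw [hlad, hlad, show 19 * (j + 1 - 2) = 19 * (j - 2) + 19 by omega, pow_add, mul_inv,
      ← mul_assoc]
    have hA : 0 < εb * ((1 + ε₀) ^ (19 * (j - 2)))⁻¹ :=
      mul_pos hεb (inv_pos.2 (lt_of_lt_of_le zero_lt_one (hpow1 _)))
    have hB : 1 ≤ 3 * ((1 + ε₀) ^ 19)⁻¹ := by
      rw [← div_eq_mul_inv, le_div_iff₀ (lt_of_lt_of_le zero_lt_one (hpow1 _))]
      linarith
    nlinarith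
  -- the bond box: `lad j / 5` for `j ≠ 1`, `Yl` for `j = 1`
  obtain ⟨Y, hY1, hYj⟩ : ∃ Y : ℕ → ℝ, Y 1 = Yl ∧ ∀ j : ℕ, j ≠ 1 → Y j = lad j / 5 :=
    ⟨fun j => if j = 1 then Yl else lad j / 5, if_pos rfl, fun j hj => if_neg hj⟩
  have hY0 : ∀ j : ℕ, 0 ≤ Y j := fun j => by
    rcases eq_or_ne j 1 with h | h
    · rw [h, hY1]
      exact hYl0
    · rw [hYj j h]
      exact div_nonneg (hlad0 j).le (by norm_num)
  have hYsq : ∀ j : ℕ, 2 ≤ j → Y (j - 1) ^ 2 ≤ lad j / 5 := by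
    intro j hj
    rcases eq_or_lt_of_le hj with h | h
    · subst h
      rw [show (2 : ℕ) - 1 = 1 from rfl, hY1, hlad2]
      linarith
    · rw [hYj (j - 1) (by omega)]
      have h3 := hladsucc (j - 1) (by omega)
      rw [show j - 1 + 1 = j by omega] at h3
      have h0 := (hlad0 (j - 1)).le
      have : (lad (j - 1) / 5) ^ 2 ≤ (3 * lad j / 5) ^ 2 :=
        pow_le_pow_left₀ (by positivity) (by linarith) 2
      have h4 : lad j ≤ 1 / 10 ^ 6 := (hladε j).trans hεb6
      nlinarith [(hlad0 j).le]
  have hcl : ∀ j : ℕ, 2 ≤ j →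
      Y (j - 1) ^ 2 / q ^ 3 + Y j ^ 2 + εb * lad j * Y j + η * lad j ≤ lad j / 2 ∧
      εb * lad j ^ 2 + η * lad j ≤ Y j / 4 ∧
      (Y (j - 1) ^ 2 / q ^ 3 + Y j ^ 2 + εb * lad j * Y j) / θ ≤ lad j / 2 ∧
      (Y j * (lad j + lad (j + 1) / q + 1) + εb * lad j ^ 2) / θ ≤ lad j / 2 := by
    intro j hj
    rw [hYj j (by omega)]
    exact pulseBoot_ladder_closure hθ hq1 hη9 hεb hεb6 (hlad0 j).le (hladε j) (hlad0 _).le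
      (hladε _) (hYsq j hj)
  -- index casts
  have hc1 : ∀ j : ℕ, 2 ≤ j → (n : ℤ) + (j : ℤ) - 1 = n + ((j - 1 : ℕ) : ℤ) := fun j hj => by omega
  have hc2 : ∀ j : ℕ, (n : ℤ) + (j : ℤ) + 1 = n + ((j + 1 : ℕ) : ℤ) := fun j => by
    push_cast
    ring
  -- hypotheses of `stub_slavedLadder`
  have h1 : ∀ j : ℕ, 2 ≤ j → ∀ σ ∈ Ioo 0 S', HasDerivAt (fun s => bv (n + j) (t₀ + s / R n))
      (R (n + j) / R n * (-(bv (n + j) (t₀ + σ / R n)) +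
        (wv (n + ((j - 1 : ℕ) : ℤ)) (t₀ + σ / R n)) ^ 2 / q ^ 3 - (wv (n + j) (t₀ + σ / R n)) ^ 2 -
        εb * bv (n + j) (t₀ + σ / R n) * wv (n + j) (t₀ + σ / R n)) +
        (db (n + j) (t₀ + σ / R n) -
          R (n + j) * (-(bv (n + j) (t₀ + σ / R n)) + G0 (n + j) (t₀ + σ / R n))) / R n) σ := by
    intro j hj σ hσ
    refine ((hpk (n + j)).1.2.2.2.2.1 σ hσ).congr_deriv ?_
    rw [hG0, hc1 j hj]
    ring
  have h2 : ∀ j : ℕ, 2 ≤ j → ∀ σ ∈ Ioo 0 S', HasDerivAt (fun s => wv (n + j) (t₀ + s / R n))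
      (R (n + j) / R n * (wv (n + j) (t₀ + σ / R n) *
          (bv (n + j) (t₀ + σ / R n) - bv (n + ((j + 1 : ℕ) : ℤ)) (t₀ + σ / R n) / q - 1) +
        εb * (bv (n + j) (t₀ + σ / R n)) ^ 2) +
        (dw (n + j) (t₀ + σ / R n) -
          R (n + j) * (-(wv (n + j) (t₀ + σ / R n)) + G1 (n + j) (t₀ + σ / R n))) / R n) σ := by
    intro j _ σ hσ
    refine ((hpk (n + j)).2.2.2.2.2.1 σ hσ).congr_deriv ?_
    rw [hG1, hc2 j]
    ring
  have h3 : ∀ j : ℕ, 2 ≤ j → ∀ σ ∈ Icc 0 S', 0 ≤ M0 (n + j) (t₀ + σ / R n) ∧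
      M0 (n + j) (t₀ + σ / R n) ≤ M0 (n + j) (t₀ + 0 / R n) * Real.exp (-(θ * (R (n + j) / R n) * σ)) +
        R (n + j) / R n * ∫ u in (0 : ℝ)..σ, Real.exp (-(θ * (R (n + j) / R n) * (σ - u))) *
          |(wv (n + ((j - 1 : ℕ) : ℤ)) (t₀ + u / R n)) ^ 2 / q ^ 3 - (wv (n + j) (t₀ + u / R n)) ^ 2 -
            εb * bv (n + j) (t₀ + u / R n) * wv (n + j) (t₀ + u / R n)| := by
    intro j hj σ hσ
    have := (hpk (n + j)).1.2.2.2.2.2.2 σ hσ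
    simp only [hG0, hc1 j hj] at this
    exact this
  have h4 : ∀ j : ℕ, 2 ≤ j → ∀ σ ∈ Icc 0 S', 0 ≤ M1 (n + j) (t₀ + σ / R n) ∧
      M1 (n + j) (t₀ + σ / R n) ≤ M1 (n + j) (t₀ + 0 / R n) * Real.exp (-(θ * (R (n + j) / R n) * σ)) +
        R (n + j) / R n * ∫ u in (0 : ℝ)..σ, Real.exp (-(θ * (R (n + j) / R n) * (σ - u))) *
          |wv (n + j) (t₀ + u / R n) *
              (bv (n + j) (t₀ + u / R n) - bv (n + ((j + 1 : ℕ) : ℤ)) (t₀ + u / R n) / q) +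
            εb * (bv (n + j) (t₀ + u / R n)) ^ 2| := by
    intro j _ σ hσ
    have := (hpk (n + j)).2.2.2.2.2.2.2 σ hσ
    simp only [hG1, hc2 j] at this
    exact this
  have h5 : ContinuousOn (fun σ => wv (n + ((1 : ℕ) : ℤ)) (t₀ + σ / R n)) (Icc 0 S') :=
    (hpk (n + ((1 : ℕ) : ℤ))).2.1
  have h6 : ∀ σ ∈ Icc 0 S', |wv (n + ((1 : ℕ) : ℤ)) (t₀ + σ / R n)| ≤ Y 1 := by
    intro σ hσ
    rw [hY1, Nat.cast_one]
    exact hL1 _ (hmem σ hσ)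
  have h7 : ∀ j : ℕ, max J 2 ≤ j → ∀ σ ∈ Icc 0 S', |bv (n + j) (t₀ + σ / R n)| ≤ lad j ∧
      |wv (n + j) (t₀ + σ / R n)| ≤ Y j ∧ M0 (n + j) (t₀ + σ / R n) ≤ lad j ∧
      M1 (n + j) (t₀ + σ / R n) ≤ lad j := by
    intro j hj σ hσ
    obtain ⟨a1, a2, a3, a4⟩ := hJ j (le_of_max_le_left hj) _ (hmemT σ hσ)
    rw [hYj j (by have := le_of_max_le_right hj; omega)]
    exact ⟨a1, a2, a3, a4⟩
  have h8 : ∀ j : ℕ, 2 ≤ j → |bv (n + j) (t₀ + 0 / R n)| ≤ lad j ∧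
      |wv (n + j) (t₀ + 0 / R n)| ≤ Y j ∧ M0 (n + j) (t₀ + 0 / R n) ≤ lad j ∧
      M1 (n + j) (t₀ + 0 / R n) ≤ lad j := by
    intro j hj
    rw [ht00, hYj j (by omega)]
    exact hInvL j hj
  have key := stub_slavedLadder (fun j σ => bv (n + j) (t₀ + σ / R n))
    (fun j σ => wv (n + j) (t₀ + σ / R n)) (fun j σ => M0 (n + j) (t₀ + σ / R n))
    (fun j σ => M1 (n + j) (t₀ + σ / R n))
    (fun j σ => (db (n + j) (t₀ + σ / R n) -
      R (n + j) * (-(bv (n + j) (t₀ + σ / R n)) + G0 (n + j) (t₀ + σ / R n))) / R n)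
    (fun j σ => (dw (n + j) (t₀ + σ / R n) -
      R (n + j) * (-(wv (n + j) (t₀ + σ / R n)) + G1 (n + j) (t₀ + σ / R n))) / R n)
    lad Y lad lad (fun j => R (n + j) / R n) q θ η εb S' (max J 2) hq1 hθ hθ1 hη hεb hS'0
    (le_max_right _ _) (fun j _ => hκ1 j)
    (fun j _ => ⟨(hlad0 j).le, hY0 j, (hlad0 j).le, (hlad0 j).le⟩)
    (fun j _ => (hladε j).trans (hεb6.trans (by norm_num))) hcl
    (fun j _ => ⟨(hpk (n + j)).1.1, (hpk (n + j)).2.1, (hpk (n + j)).1.2.1, (hpk (n + j)).2.2.1,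
      (hpk (n + j)).1.2.2.2.1, (hpk (n + j)).2.2.2.2.1⟩)
    h5 h1 h2
    (fun j _ σ hσ => ⟨(hpk (n + j)).1.2.2.2.2.2.1 σ hσ, (hpk (n + j)).2.2.2.2.2.2.1 σ hσ⟩)
    h3 h4 h6 h7 h8
  intro j hj u hu
  have hσu : R n * (u - t₀) ∈ Icc 0 S' :=
    ⟨mul_nonneg hRn.le (by linarith [hu.1]), mul_le_mul_of_nonneg_left (by linarith [hu.2]) hRn.le⟩
  obtain ⟨k1, k2, k3, k4⟩ := key j hj _ hσu
  rw [hYj j (by omega)] at k2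
  rw [htime1 u] at k1 k2 k3 k4
  exact ⟨k1, k2, k3, k4⟩

/-- **Registered tools sub-goal `stub_pulseBootLadder`** of the stub `pulseBoot` (line `Sketch`,
crux stmt-NavierStokesRegularity-1835): the ladder box is closed under the forcings with the loose
next-bond feed `Yp² ≤ L/5` (`pulseBoot_ladder_closure`). [folklore] -/
theorem stub_pulseBootLadder :
    ∀ (L Lp Yp εb η θ q : ℝ), 1 / 2 ≤ θ → 1 ≤ q → η ≤ 1 / 10 ^ 9 → 0 < εb → εb ≤ 1 / 10 ^ 6 →
      0 ≤ L → L ≤ εb → 0 ≤ Lp → Lp ≤ εb → Yp ^ 2 ≤ L / 5 →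
      Yp ^ 2 / q ^ 3 + (L / 5) ^ 2 + εb * L * (L / 5) + η * L ≤ L / 2 ∧
      εb * L ^ 2 + η * L ≤ L / 5 / 4 ∧
      (Yp ^ 2 / q ^ 3 + (L / 5) ^ 2 + εb * L * (L / 5)) / θ ≤ L / 2 ∧
      (L / 5 * (L + Lp / q + 1) + εb * L ^ 2) / θ ≤ L / 2 :=
  fun _ _ _ _ _ _ _ h1 h2 h3 h4 h5 h6 h7 h8 h9 h10 =>
    pulseBoot_ladder_closure h1 h2 h3 h4 h5 h6 h7 h8 h9 h10

end Summit.NavierStokesRegularity.NavierStokesRegularity.Theorems.PerpetualPumpAveragedTypeIBlowup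

end
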